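import Mathlib
import HarnessLib
import Summits.HubbardSuperconductivity.HubbardSuperconductivity.Theorems.LiebTwinNoOnsiteODLROHalfFillingEndpoint
import Summits.HubbardSuperconductivity.HubbardSuperconductivity.Theorems.LiebTwinDWavePolarisedDiscordanceStubExtendedSSubordinateOfNoOnsite
import Summits.HubbardSuperconductivity.HubbardSuperconductivity.Theorems.LiebTwinDWavePolarisedDiscordancePairTransfer

/-!
# The `δ = 0` endpoint of `NoOnsiteODLRO`, whole `A1g` channel: no extended-`s` pair condensation at half filling

Helper file (`--supports stmt-HubbardSuperconductivity-0933`, crux `NoOnsiteODLRO` shared by the routes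
`LiebTwin` / `EnslavedA1g`; route-prover LiebTwin-0, session 9). Under a strict pair window the crux is
exactly "no `A1g` (on-site ⊕ extended-`s`) pair long-range order" of the doped repulsive ground states
(research-open, crux census). Its `δ = 0` endpoint was landed for the ON-SITE channel in
`LiebTwinNoOnsiteODLROHalfFillingEndpoint` (`onsitePairing_halfFilled_le`: `Re⟨ψ,P_sᴴP_sψ⟩ ≤ √(8/U)·L²`,
Kubo–Kishi Gaussian domination at `T = 0` + Falk–Bruch + pseudospin). This file completes the endpoint for
the EXTENDED-`s` channel, by the per-eigenvector `A1g` slaving bound of route `EnslavedA1g`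
(`Theorems.extendedS_sq_le_of_eigen`: `‖P_{s'}ψ‖² ≤ K L² ‖P_sψ‖ + U²‖P_sψ‖²/4` for every normalised
eigenvector, `K = K(U)` the commutator-locality constant):

* `extendedSPairing_halfFilled_le` — for `U > 0`, `L ≥ 3` even and every normalised ground state `ψ` of
  `hubbardTorus 2 L 1 U` in the joint sector `(L², S^z = 0)`:
  **`Re⟨ψ, P_{s'}ᴴ P_{s'} ψ⟩ ≤ K (8/U)^{1/4} L³ + (U²/4)√(8/U) L²`** (`P_{s'} = pairField extendedSWave L`),
  i.e. the extended-`s` pair order of the half-filled repulsive torus is `O(L³) = o(L⁴)`;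
* `extendedSPairing_halfFilled_le_explicit` — the same with the tree's explicit locality constant
  `K = 2√2 · 72 · (2 + U)` (`norm_commutator_hubbardTorus_pairField_le`, `Σ_e |ĝ_{s'}(e)|/√2 = 2√2`);
* `stub_noExtendedSPairing_halfFilling` (registered stub) — hence for every sequence of normalised
  half-filled sector ground states `Re⟨ψ_L, P_{s'}ᴴP_{s'}ψ_L⟩/L⁴ → 0`: together with
  `stub_noOnsiteODLRO_halfFilling`, the half-filled repulsive Hubbard torus has no pair condensation in
  the whole `A1g = {on-site, extended-s}` channel at `T = 0`.

References: K. Kubo, T. Kishi, Phys. Rev. B 41 (1990) 4866, Thm 2 [KuboKishi1990] (on-site channel,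
`T > 0`); S.-C. Zhang, Phys. Rev. Lett. 65 (1990) 120 [Zhang1990] and G.-S. Tian, J. Phys. A 27 (1994)
6677 (commutator / slaving method). Everything is proved (standard axioms); no definition, no named fact.
-/

-- the mandated namespace `Summit.<Summit>.<Problem>.Theorems` repeats `HubbardSuperconductivity`
set_option linter.dupNamespace false

noncomputable section

namespace Summit.HubbardSuperconductivity.HubbardSuperconductivity.Theorems.NoOnsiteODLRO.HalfFilling

open Matrix Finset
open Literature.Probability.LatticeModels Literature.MathematicalPhysics.QuantumLattice
open Summit.HubbardSuperconductivity.EnslavedA1g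
open scoped Matrix.Norms.L2Operator ComplexOrder

section ExtendedS

variable {L : ℕ} [NeZero L]

/-- **No extended-`s` pair condensation at half filling (quantitative).** For `U > 0`, `L ≥ 3` even,
`L² = 2(m+1)`, a commutator-locality constant `K` of the extended-`s` pair field
(`‖[H, P_{s'}]‖ ≤ K L²` at every side) and every normalised ground state `ψ` of `hubbardTorus 2 L 1 U`
in the joint sector `(L², S^z = 0)`:
`Re⟨ψ, P_{s'}ᴴP_{s'}ψ⟩ ≤ K · √(√(8/U)) · L³ + U² √(8/U) L² / 4`.
Proof: the slaving bound `‖P_{s'}ψ‖² ≤ K L² ‖P_sψ‖ + U²‖P_sψ‖²/4` (`extendedS_sq_le_of_eigen`) and the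
on-site endpoint `‖P_sψ‖² ≤ √(8/U) L²` (`onsitePairing_halfFilled_le`). Kubo–Kishi, PRB 41 (1990) 4866,
Thm 2; Zhang, PRL 65 (1990) 120. [cite: KuboKishi1990, Theorem 2] -/
theorem extendedSPairing_halfFilled_le {U K : ℝ}
    (hK : ∀ (L : ℕ) [NeZero L],
      ‖hubbardTorus 2 L 1 U * pairField extendedSWave L -
          pairField extendedSWave L * hubbardTorus 2 L 1 U‖ ≤ K * (L : ℝ) ^ 2)
    (hL : Even L) (h3 : 3 ≤ L) (hU : 0 < U) {m : ℕ} (hm : 2 * (m + 1) = L ^ 2)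
    {ψ : Fock (Orb (FermionTorus 2 L))} (hψ1 : star ψ ⬝ᵥ ψ = 1)
    (hψ : IsGroundStateInSector (hubbardTorus 2 L 1 U) (2 * (m + 1)) 0 ψ) :
    (expect ((pairField extendedSWave L)ᴴ * pairField extendedSWave L) ψ).re ≤
      K * Real.sqrt (Real.sqrt (8 / U)) * (L : ℝ) ^ 3 +
        U ^ 2 * Real.sqrt (8 / U) * (L : ℝ) ^ 2 / 4 := by
  have hS := onsitePairing_halfFilled_le hL h3 hU hm hψ1 hψ
  have hX := Theorems.extendedS_sq_le_of_eigen hK L (by omega) ψ hψ1 hψ.2.2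
  have hA2 : (expect ((pairField extendedSWave L)ᴴ * pairField extendedSWave L) ψ).re =
      eucNorm (pairField extendedSWave L *ᵥ ψ) ^ 2 :=
    re_star_dotProduct_conjTranspose_mul_self_mulVec _ _
  have hB2 : (expect ((pairField sWave L)ᴴ * pairField sWave L) ψ).re =
      eucNorm (pairField sWave L *ᵥ ψ) ^ 2 :=
    re_star_dotProduct_conjTranspose_mul_self_mulVec _ _
  set b : ℝ := eucNorm (pairField sWave L *ᵥ ψ) with hb
  have hb0 : 0 ≤ b := eucNorm_nonneg _
  have hLpos : (0 : ℝ) < L := by exact_mod_cast Nat.pos_of_ne_zero (NeZero.ne L)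
  -- `b² ≤ √(8/U) L²`, hence `b ≤ √(√(8/U)) · L`
  have hb2 : b ^ 2 ≤ Real.sqrt (8 / U) * (L : ℝ) ^ 2 := by rw [hb, ← hB2]; exact hS
  have hb1 : b ≤ Real.sqrt (Real.sqrt (8 / U)) * (L : ℝ) := by
    have h : b ≤ Real.sqrt (Real.sqrt (8 / U) * (L : ℝ) ^ 2) := by
      rw [← Real.sqrt_sq hb0]
      exact Real.sqrt_le_sqrt hb2
    rwa [Real.sqrt_mul (Real.sqrt_nonneg _), Real.sqrt_sq hLpos.le] at h
  -- `K ≥ 0` is forced by the hypothesis at side `L` (a norm is nonnegative)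
  have hK0 : 0 ≤ K := by
    have h := (norm_nonneg _).trans (hK L)
    exact nonneg_of_mul_nonneg_left h (by positivity)
  rw [hA2]
  calc eucNorm (pairField extendedSWave L *ᵥ ψ) ^ 2
      ≤ K * (L : ℝ) ^ 2 * b + U ^ 2 * b ^ 2 / 4 := hX
    _ ≤ K * (L : ℝ) ^ 2 * (Real.sqrt (Real.sqrt (8 / U)) * (L : ℝ)) +
          U ^ 2 * (Real.sqrt (8 / U) * (L : ℝ) ^ 2) / 4 := by
        gcongr
    _ = K * Real.sqrt (Real.sqrt (8 / U)) * (L : ℝ) ^ 3 +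
          U ^ 2 * Real.sqrt (8 / U) * (L : ℝ) ^ 2 / 4 := by ring

/-- The `ℓ¹`-mass of the normalised extended-`s` form factor over `{0} ∪ unitSteps`:
`Σ_e ‖ĝ_{s'}(e)/√2‖ = 4/√2 = 2√2` (`ĝ_{s'}(0) = 0`, `ĝ_{s'}(±e_i) = 1`). [folklore] -/
theorem sum_norm_extendedSWave_div_sqrt_two :
    ∑ e ∈ insert (0 : Literature.Probability.LatticeModels.Site 2) unitSteps,
        ‖((extendedSWave e / Real.sqrt 2 : ℝ) : ℂ)‖ = 2 * Real.sqrt 2 := by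
  have h : ∀ e ∈ insert (0 : Literature.Probability.LatticeModels.Site 2) unitSteps,
      ‖((extendedSWave e / Real.sqrt 2 : ℝ) : ℂ)‖ = |extendedSWave e| / Real.sqrt 2 := by
    intro e _
    rw [Complex.norm_real, Real.norm_eq_abs, abs_div, abs_of_pos (Real.sqrt_pos.2 two_pos)]
  rw [Finset.sum_congr rfl h, ← Finset.sum_div,
    LiebTwinDiscordance.sum_abs_extendedSWave]
  rw [div_eq_iff (Real.sqrt_pos.2 two_pos).ne']
  nlinarith [Real.mul_self_sqrt (show (0 : ℝ) ≤ 2 by norm_num)]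

/-- **No extended-`s` pair condensation at half filling, explicit constant.** With the tree's
locality constant `K = 2√2 · 72 · (2 + U)` (`norm_commutator_hubbardTorus_pairField_le` and
`sum_norm_extendedSWave_div_sqrt_two`): for `U > 0`, `L ≥ 3` even, `L² = 2(m+1)` and every normalised
ground state `ψ` of the sector `(L², S^z = 0)`,
`Re⟨ψ, P_{s'}ᴴP_{s'}ψ⟩ ≤ 144√2(2+U) √(√(8/U)) L³ + U² √(8/U) L²/4`. Kubo–Kishi, PRB 41 (1990) 4866,
Thm 2; Zhang, PRL 65 (1990) 120. [cite: KuboKishi1990, Theorem 2] -/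
theorem extendedSPairing_halfFilled_le_explicit (hL : Even L) (h3 : 3 ≤ L) {U : ℝ} (hU : 0 < U)
    {m : ℕ} (hm : 2 * (m + 1) = L ^ 2) {ψ : Fock (Orb (FermionTorus 2 L))}
    (hψ1 : star ψ ⬝ᵥ ψ = 1) (hψ : IsGroundStateInSector (hubbardTorus 2 L 1 U) (2 * (m + 1)) 0 ψ) :
    (expect ((pairField extendedSWave L)ᴴ * pairField extendedSWave L) ψ).re ≤
      2 * Real.sqrt 2 * (72 * (2 + U)) * Real.sqrt (Real.sqrt (8 / U)) * (L : ℝ) ^ 3 +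
        U ^ 2 * Real.sqrt (8 / U) * (L : ℝ) ^ 2 / 4 := by
  have hK : ∀ (L : ℕ) [NeZero L],
      ‖hubbardTorus 2 L 1 U * pairField extendedSWave L -
          pairField extendedSWave L * hubbardTorus 2 L 1 U‖ ≤
        2 * Real.sqrt 2 * (72 * (2 + U)) * (L : ℝ) ^ 2 := by
    intro L _
    have h := norm_commutator_hubbardTorus_pairField_le extendedSWave U L
    rwa [sum_norm_extendedSWave_div_sqrt_two, abs_of_pos hU] at h
  exact extendedSPairing_halfFilled_le hK hL h3 hU hm hψ1 hψ

end ExtendedS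

section Endpoint

/-- **Registered stub `stub_noExtendedSPairing_halfFilling`** of crux `NoOnsiteODLRO`
(stmt-HubbardSuperconductivity-0933; by-product — the `δ = 0` ENDPOINT of the crux's strict-window
reformulation "no `A1g` pair LRO", extended-`s` half; not a piece of a line composition): for every
`U > 0` and every sequence `ψ_L` of normalised ground states of `hubbardTorus 2 L 1 U` in the half-filled
joint sector `(L², S^z = 0)` (even `L`), the extended-`s` pair order density vanishes,
`∀ ε > 0, ∃ L₀, ∀ even L ≥ L₀, Re⟨ψ_L, P_{s'}ᴴP_{s'}ψ_L⟩ / L⁴ ≤ ε` — indeed it is `O(1/L)`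
(`extendedSPairing_halfFilled_le`). With `stub_noOnsiteODLRO_halfFilling` (on-site half): no `A1g` pair
condensation at half filling. Off half filling (`δ ∈ (0,1/2)`, the crux) no such statement is known.
Kubo–Kishi, PRB 41 (1990) 4866, Thm 2; Zhang, PRL 65 (1990) 120; Tian, J. Phys. A 27 (1994) 6677.
[cite: KuboKishi1990, Theorem 2] -/
theorem stub_noExtendedSPairing_halfFilling : open Literature.MathematicalPhysics.QuantumLattice in ∀ (U : ℝ), 0 < U → ∀ (ψ : ∀ L : ℕ, Fock (Orb (FermionTorus 2 L))), (∀ (L : ℕ) [NeZero L], Even L → star (ψ L) ⬝ᵥ ψ L = 1 ∧ IsGroundStateInSector (hubbardTorus 2 L 1 U) (L ^ 2) 0 (ψ L)) → ∀ ε : ℝ, 0 < ε → ∃ L₀ : ℕ, ∀ (L : ℕ) [NeZero L], Even L → L₀ ≤ L → (expect ((pairField extendedSWave L)ᴴ * pairField extendedSWave L) (ψ L)).re / (L : ℝ) ^ 4 ≤ ε := by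
  intro U hU ψ hψ ε hε
  obtain ⟨K, hK0, hK⟩ := exists_norm_commutator_hubbardTorus_pairField_le extendedSWave U
  -- the bound is `C₁ L³ + C₂ L² ≤ (C₁ + C₂) L³` for `L ≥ 1`; choose `L > (C₁ + C₂)/ε`
  set C₁ : ℝ := K * Real.sqrt (Real.sqrt (8 / U)) with hC₁
  set C₂ : ℝ := U ^ 2 * Real.sqrt (8 / U) / 4 with hC₂
  have hC₁0 : 0 ≤ C₁ := by positivity
  have hC₂0 : 0 ≤ C₂ := by positivity
  refine ⟨max 3 (⌈(C₁ + C₂) / ε⌉₊ + 1), fun L _ hL hL₀ => ?_⟩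
  have h3 : 3 ≤ L := le_trans (le_max_left _ _) hL₀
  have hLε : (C₁ + C₂) / ε < L := by
    have h1 : (⌈(C₁ + C₂) / ε⌉₊ + 1 : ℕ) ≤ L := le_trans (le_max_right _ _) hL₀
    have h2 : (C₁ + C₂) / ε ≤ ⌈(C₁ + C₂) / ε⌉₊ := Nat.le_ceil _
    have h3' : ((⌈(C₁ + C₂) / ε⌉₊ + 1 : ℕ) : ℝ) ≤ L := by exact_mod_cast h1
    push_cast at h3'
    linarith
  obtain ⟨m, hm⟩ := exists_two_mul_succ_eq_sq (L := L) hL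
  obtain ⟨hψ1, hgs⟩ := hψ L hL
  rw [← hm] at hgs
  have hX := extendedSPairing_halfFilled_le hK hL h3 hU hm hψ1 hgs
  have hLpos : (0 : ℝ) < L := by exact_mod_cast (show 0 < L by omega)
  have hL1 : (1 : ℝ) ≤ L := by exact_mod_cast (show 1 ≤ L by omega)
  rw [div_le_iff₀ (by positivity)]
  have hε' : C₁ + C₂ < ε * L := by rwa [div_lt_iff₀ hε, mul_comm] at hLε
  have hL23 : C₂ * (L : ℝ) ^ 2 ≤ C₂ * (L : ℝ) ^ 3 := by
    have : (L : ℝ) ^ 2 ≤ (L : ℝ) ^ 3 := by nlinarith [pow_pos hLpos 2]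
    exact mul_le_mul_of_nonneg_left this hC₂0
  have hL34 : ε * L * (L : ℝ) ^ 3 = ε * (L : ℝ) ^ 4 := by ring
  calc (expect ((pairField extendedSWave L)ᴴ * pairField extendedSWave L) (ψ L)).re
      ≤ C₁ * (L : ℝ) ^ 3 + C₂ * (L : ℝ) ^ 2 := by
        have h := hX
        rw [hC₁, hC₂]
        linarith [h]
    _ ≤ (C₁ + C₂) * (L : ℝ) ^ 3 := by nlinarith [hL23]
    _ ≤ ε * L * (L : ℝ) ^ 3 := by
        have hL3 : (0 : ℝ) ≤ (L : ℝ) ^ 3 := by positivity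
        exact mul_le_mul_of_nonneg_right hε'.le hL3
    _ = ε * (L : ℝ) ^ 4 := hL34

end Endpoint

end Summit.HubbardSuperconductivity.HubbardSuperconductivity.Theorems.NoOnsiteODLRO.HalfFilling
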